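import Summits.ABC.ABC.Theses.RibetTakahashiSplit
import Literature.NumberTheory.Automorphic.QuaternionAlgebraAdelic
import Literature.NumberTheory.Automorphic.BrandtXi
import Literature.NumberTheory.Automorphic.HyperbolicLaplaceSpectrum
import Literature.NumberTheory.EllipticCurves.ModularCurve
import Literature.NumberTheory.EllipticCurves.GlobalMinimalModel
import Literature.NumberTheory.EllipticCurves.Szpiro
import Literature.NumberTheory.DiophantineGeometry.ConductorRadicalProofs

/-!
# Line `jl-zero-cycle-height` — skeleton for crux `RibetTakahashiSplit.ManyPrimeValuationProduct`
# (stmt-ABC-1561, route-ABC-RibetTakahashiSplit, rank 2)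

See `Lines/jl-zero-cycle-height.md` (the line card) for the prose: idea, stubs, hardest stub,
barriers, Disproof used, triage answers.

THE CRUX. `T(E) := ∏_{p ∥ N} ord_p(Δ_min) ≤ C_ε N^ε` for every `E/ℚ` semistable away from `2` with
`≥ 4` odd multiplicative primes.

THE LINE (card `Ideas/jl-zero-cycle-height.md`, 3 × pass). For an even set `D` of multiplicative
primes with co-level `M = N/∏D`, let `X = X_0^D(M) = Γ\ℍ` be the Shimura curve and `s` a weight-2
form on `X` whose periods lie in the Néron lattice `Λ_E` (= the pull-back `φ^*ω_E` of the Néron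
differential under a parametrisation `φ : X → E`; Pasten's integral `f_{D,M}` is such a form up to
a bounded factor). Ribet–Takahashi–Pasten (arXiv:1705.09251 Thm 6.1(b), §16 (EqRTF)) + Frey–Zagier
on both curves + `‖f_E‖² ≪ N log N` + `vol(X) = (π/3)φ(D)ψ(M)` give the PACKAGE INEQUALITY
  `log T_D ≤ C + ε log N + log vol(X) − log ∫_X ‖s‖²_pt dμ`            (`stub_jlPackage`, KNOWN),
and Jensen (`mean log ≤ log mean`, PROVED below) turns it into
  `log T_D ≤ C + ε log N − mean_X log ‖s‖²_pt`.
The hard core is the GEOMETRIC-MEAN LOWER BOUND `mean_X log ‖s‖²_pt ≥ −ε log N − C`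
(`stub_zeroCycleHeight`, OPEN) — by the arithmetic adjunction formula `ω̂·d̂iv(s) = ω̂²` on a regular
model this is VERBATIM the card's `ZeroCycleHeight : h_ω̂(Z(s)) + V(s) ≥ ω̂² − (ε/2)·d·log N` (the
zeros of the integral Jacquet–Langlands eigenform sit at the Jensen ceiling); it is stated here in
its complex-analytic dress, over the tree's Fuchsian/quaternionic vocabulary, so that it needs no
Arakelov theory to TYPE. Two arithmetic stubs close the skeleton honestly over the crux's FULL class:
the Diophantine input of Pasten's cokernel bound Thm 6.17 — "the multiplicative part of `Δ_min` is
not a perfect `ℓ`-th power, `ℓ ≥ 11`" — split into `stub_fermatInputKnown` (semistable `E`: Pasten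
L.6.11, Mazur–Ribet–Wiles; Frey–Hellegouarch `E` and twists by `±1, ±2`: L.6.12, Wiles, Ribet,
Darmon–Merel — KNOWN, and everything the route's Assembly feeds in) and `stub_fermatInputResidual`
(curves additive at `2` without a Frey model — OPEN, foreign: the only part of the class the JL
engine does not reach in print). The covering glue (`≤ 3` even co-level-`≥ 2` sets cover all
multiplicative primes; `T ≤ T_{D₁}T_{D₂}T_{D₃}`) and Jensen's inequality are PROVED here.

`ManyPrimeValuationProduct_of` composes the four stubs into the crux BY NAME (kernel-checked; no
`sorry` outside the four `stub_*`, which it invokes): Fermat input + package + Jensen + zero-cycle height ⟹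
`PairedFactorisationBound` (`pairedFactorisationBound_of`) ⟹ crux (`coveringGlue`);
`pairedBoundTheta_of` is the kernel-checked θ-ladder (`T_D ≤ C N^{θ+ε}` from the θ-weakened lever).

## Disproof used (cdisprove `Disproof.lean` v4, 2026-08-15T22:48Z, rc 0; known through its evidence
notes only — `run/gate/evidence/**` is not mounted on this hub and `Cruxes/…/Disproof.lean` is not
written; no `Theorems/ManyPrimeValuationProduct/Negative/` exists, checked 2026-08-16)
* §3 `manyPrimeValuationProduct_false_without_epsilon` / `_false_uniform_constant`, §4
  `_false_polylog` (Frey family `W_{B,k}`: `T ≥ (2(k+1))^{ω(B)}`) — HONOURED: every statement here is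
  `∀ ε > 0 ∃ C` with `C` depending on `ε` (`PairedFactorisationBound`, `JLPackage`,
  `ZeroCycleHeight(Theta)`); nothing ε-free or polylog is stated. The line USES ε at `stub_jlPackage`
  (`ω(N) log κ ≤ ε log N + C_ε`, `(f,f) ≪ N log N`, `log log N` losses) and at `stub_zeroCycleHeight`
  (the `ε d log N` slack below the Jensen ceiling; on `W_{B,k}` the zero cycle must sit
  `≍ ω(B) log k` below the ceiling — allowed).
* §2 `manyPrime_of_abc` / §5 `manyPrime_of_quasiPolySzpiro` (crux ⟸ exp((log N)^{1+o(1)})-Szpiro) —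
  consistent calibration: the line's output per covering set is `T_D ≤ C_ε N^ε`, no Szpiro-type
  statement is claimed or used.
* §6 `factorization_le_of_manyPrime` (crux ⇒ `v_p ≤ C_ε N^ε`) — consistent; not engaged.
* `ledger negatives --problem ABC` = stmt-ABC-1689 (GlobalQuasiLogDerivative), stmt-ABC-1205
  (BelyiSqueeze): unrelated; no stub is an instance of either.
-/

set_option linter.dupNamespace false

noncomputable section

open MeasureTheory
open scoped MatrixGroups

namespace Summit.ABC.ABC.Cruxes.ManyPrimeValuationProduct.JlZeroCycleHeight

open Literature.NumberTheory.Automorphic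
open Literature.NumberTheory.EllipticCurves.ModularForms (IsNeronLatticeOf)
open Literature.NumberTheory.EllipticCurves (freyCurve)
open Summit.ABC.ABC.Theses.RibetTakahashiSplit (ManyPrimeValuationProduct)

/-! ## Arithmetic vocabulary (the crux's own: conductor, minimal discriminant, valuations) -/

/-- The multiplicative primes of `W`: prime factors `p` of the conductor `N` with `p² ∤ N`
(exactly the index set of the crux's product `T(E)`; contains `2` iff `2 ∥ N`). -/
def multPrimes (W : WeierstrassCurve ℚ) : Finset ℕ :=
  (W.conductorNorm ℤ).primeFactors.filter (fun p => ¬ p ^ 2 ∣ W.conductorNorm ℤ)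

/-- `T_D(E) = ∏_{p ∈ D} ord_p(Δ_min(E))`, the valuation product over a set of primes `D`. -/
def valProd (W : WeierstrassCurve ℚ) (D : Finset ℕ) : ℕ :=
  ∏ p ∈ D, (W.minimalDiscriminantNorm ℤ).factorization p

/-- Semistable away from `2`: `p² ∤ N` for every odd prime `p` (the crux's standing hypothesis). -/
def IsSemistableAwayFromTwo (W : WeierstrassCurve ℚ) : Prop :=
  ∀ p : ℕ, p.Prime → p ≠ 2 → ¬ p ^ 2 ∣ W.conductorNorm ℤ

/-- A COVERING SET of the line: an even set `D` of `≥ 2` multiplicative primes whose complement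
in the multiplicative primes still has `≥ 2` elements — so the co-level `M = N/∏D` is divisible by
two multiplicative primes: Pasten's hypothesis (b.1) (`M` not prime) for semistable `E`, (b.2)
(`M` divisible by two odd primes) for Frey–Hellegouarch `E`, and the hypothesis of his Lemma 6.16
in general (triage r1-1/r1-3 sharpening (a): admissibility INSIDE the bound). -/
def IsCoveringSet (W : WeierstrassCurve ℚ) (D : Finset ℕ) : Prop :=
  D ⊆ multPrimes W ∧ Even D.card ∧ 2 ≤ D.card ∧ 2 ≤ (multPrimes W \ D).card

/-- The level pair of a covering set: `D' = ∏_{p ∈ D} p` (squarefree, even `ω`) and `M = N/D'`. -/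
def discOf (D : Finset ℕ) : ℕ := ∏ p ∈ D, p

/-- **FERMAT INPUT** at a curve (the Diophantine heart of Pasten's Thm 6.17 / Thm 6.1(b)): for every
prime `ℓ ≥ 11` some multiplicative prime `r` has `ℓ ∤ ord_r(Δ_min)`, i.e. the multiplicative part of
the minimal discriminant is not a perfect `ℓ`-th power. -/
def FermatInput (W : WeierstrassCurve ℚ) : Prop :=
  ∀ ℓ : ℕ, ℓ.Prime → 11 ≤ ℓ → ∃ r ∈ multPrimes W, ¬ ℓ ∣ (W.minimalDiscriminantNorm ℤ).factorization r

/-- Semistable: `p² ∤ N` for every prime `p` (`2` included). -/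
def IsSemistable (W : WeierstrassCurve ℚ) : Prop :=
  ∀ p : ℕ, p.Prime → ¬ p ^ 2 ∣ W.conductorNorm ℤ

/-- `W` is `ℚ`-isomorphic to a Frey–Hellegouarch curve `y² = x(x − da)(x + db)` with `a, b` coprime,
`ab(a+b) ≠ 0`, `d ∣ 2` (the tree's `freyCurve`, twisted by `d ∈ {±1, ±2}`): within the curves
semistable away from `2` these are exactly the curves with full rational `2`-torsion. -/
def IsFreyIsomorphic (W : WeierstrassCurve ℚ) : Prop :=
  ∃ (a b d : ℤ) (C : WeierstrassCurve.VariableChange ℚ),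
    IsCoprime a b ∧ a * b * (a + b) ≠ 0 ∧ d ∣ 2 ∧ C • W = freyCurve (d * a) (d * b)

/-- **Statement of stub 1 — the Fermat input where it is KNOWN**: semistable curves (Pasten L.6.11:
`Δ_E` is not a perfect `ℓ`-th power, `ℓ ≥ 11` — Mazur, Ribet's level lowering, Wiles) and
Frey–Hellegouarch curves and their twists by `±1, ±2` (L.6.12: the odd part of `Δ_E = 2^s(abc)²` is
not an `ℓ`-th power, `ℓ ≥ 3` — Wiles, Ribet, Darmon–Merel). In print; formalisation debt = FLT
technology (lands as a named Literature fact, after which this stub is one line). -/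
def FermatInputKnown : Prop :=
  ∀ (W : WeierstrassCurve ℚ) [W.IsElliptic], IsSemistableAwayFromTwo W →
    4 ≤ (multPrimes W).card → (IsSemistable W ∨ IsFreyIsomorphic W) → FermatInput W

/-- **Statement of stub 2 — the Fermat input on the RESIDUAL class** (additive at `2`, no
Frey–Hellegouarch model; OPEN, foreign to the JL lever): the only curves of the crux's class that
Pasten's Thm 6.1(b) does not reach in print. A generalized-Fermat statement: such a curve with all
multiplicative exponents `≡ 0 (ℓ)` solves `±1728·2^s x^ℓ = c₄³ − c₆²` (Pasten L.6.10 settles each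
FIXED `ℓ` up to finitely many curves via Darmon–Granville; uniformity in `ℓ` is the open part, of
Frey–Mazur flavour: level-lowering lands on forms of level `2^t ≤ 256` instead of the empty
`S₂(Γ₀(2))`). -/
def FermatInputResidual : Prop :=
  ∀ (W : WeierstrassCurve ℚ) [W.IsElliptic], IsSemistableAwayFromTwo W →
    4 ≤ (multPrimes W).card → ¬ IsSemistable W → ¬ IsFreyIsomorphic W → FermatInput W

/-- The Fermat input on the whole class (from the two halves, by excluded middle). -/
def FermatInputOnClass : Prop :=
  ∀ (W : WeierstrassCurve ℚ) [W.IsElliptic], IsSemistableAwayFromTwo W →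
    4 ≤ (multPrimes W).card → FermatInput W

theorem fermatInputOnClass_of (hK : FermatInputKnown) (hR : FermatInputResidual) :
    FermatInputOnClass := by
  intro W _ hss h4
  by_cases h : IsSemistable W ∨ IsFreyIsomorphic W
  · exact hK W hss h4 h
  · simp only [not_or] at h
    exact hR W hss h4 h.1 h.2

/-- **The per-factorisation bound** (exponent `0`, typed arithmetic shadow of "JL preserves
integral size" on ONE Shimura curve; the card's `FactorisationBound 0` with admissibility moved
inside, as all three triagers asked): `T_D(E) ≤ C_ε N^ε` for every covering set `D`. -/
def PairedFactorisationBound : Prop :=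
  ∀ ε : ℝ, 0 < ε → ∃ C : ℝ, ∀ (W : WeierstrassCurve ℚ) [W.IsElliptic],
    IsSemistableAwayFromTwo W → ∀ D : Finset ℕ, IsCoveringSet W D →
      (valProd W D : ℝ) ≤ C * (W.conductorNorm ℤ : ℝ) ^ ε

/-- **The covering glue** (PROVED below, `coveringGlue`): the per-factorisation bound implies the
crux (with `≥ 4` odd multiplicative primes every multiplicative prime, `2` included when `2 ∥ N`,
lies in one of `≤ 3` covering sets, and `T ≤ T_{D₁} T_{D₂} T_{D₃}` because every factor is `≥ 1`). -/
def CoveringGlue : Prop :=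
  PairedFactorisationBound → ManyPrimeValuationProduct

/-! ## Shimura-curve vocabulary (POSITED INTERFACE over tree declarations; the existence of an
instance is asserted only inside `stub_jlPackage`, never by the interface) -/

/-- A **Shimura setup of level `(D, M)`**: a quaternion algebra `B/ℚ` ramified exactly at the primes
dividing the squarefree integer `D` (tree: `IsQuaternionAlgebra`, `ramifiedPlaces`), an Eichler
order `O` of level `M` in it (tree: `Brandt.IsEichlerOrder`, the definite route's definition), and a
REAL SPLITTING `ι : B ↪ M₂(ℝ)` (so `B` is indefinite). The indefinite twin of the tree's
`Brandt.XiSetup`. Such a setup exists iff `ω(D)` is even, `M ≥ 1`, `gcd(D, M) = 1` (Hilbert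
reciprocity; existence of Eichler orders; `B ⊗ ℝ ≅ M₂(ℝ)`) — NOT claimed here. -/
structure ShimuraSetup (D M : ℕ) : Type 1 where
  /-- The quaternion algebra. -/
  B : Type
  [instRing : Ring B]
  [instAlgebra : Algebra ℚ B]
  [isQuaternionAlgebra : IsQuaternionAlgebra ℚ B]
  /-- `D` is squarefree … -/
  squarefree : Squarefree D
  /-- … and `B` is ramified exactly at the primes dividing `D`: `disc B = D`. -/
  ramifiedPlaces_eq : ramifiedPlaces ℚ B =
    {v | ((Rat.HeightOneSpectrum.primesEquiv v : Nat.Primes) : ℕ) ∣ D}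
  /-- The Eichler order. -/
  O : Submodule ℤ B
  /-- `O` is an Eichler order of level `M`. -/
  isEichlerOrder : Brandt.IsEichlerOrder B O M
  /-- A real splitting `B → M₂(ℝ)` (injective `ℚ`-algebra map; it exists iff `B` is indefinite). -/
  ι : B →ₐ[ℚ] Matrix (Fin 2) (Fin 2) ℝ
  ι_injective : Function.Injective ι

namespace ShimuraSetup

variable {D M : ℕ}

instance instRingB (S : ShimuraSetup D M) : Ring S.B := S.instRing

instance instAlgebraB (S : ShimuraSetup D M) : Algebra ℚ S.B := S.instAlgebra

instance isQuaternionAlgebraB (S : ShimuraSetup D M) : IsQuaternionAlgebra ℚ S.B :=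
  S.isQuaternionAlgebra

/-- **`Γ_0^D(M)`**: the image under the real splitting of the norm-one units of the Eichler order,
as a subgroup of `GL₂(ℝ)` (generated by the matrices `ι(x)`, `x ∈ O`, of determinant `1`; that set
is already a group, the closure only bundles it). A cocompact arithmetic Fuchsian group for
`D > 1`; `Γ\ℍ = X_0^D(M)(ℂ)`. -/
def Gamma (S : ShimuraSetup D M) : Subgroup (GL (Fin 2) ℝ) :=
  Subgroup.closure {g : GL (Fin 2) ℝ |
    (∃ x ∈ S.O, S.ι x = (g : Matrix (Fin 2) (Fin 2) ℝ)) ∧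
      Matrix.det (g : Matrix (Fin 2) (Fin 2) ℝ) = 1}

end ShimuraSetup

/-- Pointwise Petersson norm `‖s‖²_pt(z) = |s(z)|² (Im z)²` of a weight-2 form (a `Γ`-invariant
function for `Γ` of determinant one). -/
def pet {Γ : Subgroup (GL (Fin 2) ℝ)} (s : CuspForm Γ 2) (z : UpperHalfPlane) : ℝ :=
  ‖s z‖ ^ 2 * z.im ^ 2

/-- `∫_z^w s(τ) dτ` along the straight segment (the upper half-plane is convex, `s` holomorphic, so
this is THE path integral). -/
def segmentIntegral (s : UpperHalfPlane → ℂ) (z w : UpperHalfPlane) : ℂ :=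
  ∫ t in (0 : ℝ)..1,
    s (UpperHalfPlane.ofComplex ((1 - (t : ℂ)) * (z : ℂ) + (t : ℂ) * (w : ℂ))) * ((w : ℂ) - (z : ℂ))

/-- The periods of `s` on `Γ` lie in `Λ`: `∫_z^{γ z} s(τ) dτ ∈ Λ` for all `γ ∈ Γ`, `z ∈ ℍ`
(for a weight-2 form `γ ↦ ∫_z^{γz} s` is a homomorphism independent of `z`). For `Λ = Λ_E` the Néron
lattice: `s(τ)dτ = φ^*(du)` for the holomorphic map `φ : Γ\ℍ → ℂ/Λ_E = E(ℂ)`, `φ(τ) = ∫_{z₀}^τ s`. -/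
def HasPeriodsIn (Γ : Subgroup (GL (Fin 2) ℝ)) (s : UpperHalfPlane → ℂ) (Λ : Set ℂ) : Prop :=
  ∀ γ ∈ Γ, ∀ z : UpperHalfPlane, segmentIntegral s z (γ • z) ∈ Λ

/-- `L` is a NÉRON period pair of the elliptic curve `W/ℚ`: the period pair of the invariant
differential of some GLOBALLY MINIMAL model `C • W` (tree: `IsGloballyMinimal`, `IsNeronLatticeOf`);
its lattice `L.lattice = Λ_E ⊆ ℂ` is the Néron lattice (independent of the choices up to sign). -/
def IsNeronPeriodPairOf (W : WeierstrassCurve ℚ) (L : PeriodPair) : Prop :=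
  ∃ C : WeierstrassCurve.VariableChange ℚ,
    (C • W).IsGloballyMinimal ∧ IsNeronLatticeOf ((C • W).baseChange ℂ) L

/-- **Statement of stub 3 — the Jacquet–Langlands / Ribet–Takahashi / Pasten PACKAGE** (known in
print, given the Fermat input as hypothesis). For every `ε > 0` there is `C` such that for every
elliptic `W/ℚ` semistable away from `2` satisfying the Fermat input and every covering set `D`
(`D' = ∏D`, `M = N/D'`) there exist: a Néron period pair `L` of `W`; a Shimura setup `S` of level
`(D', M)`; a measurable fundamental domain `F` of `Γ = S.Gamma` of finite positive hyperbolic area;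
and a NON-ZERO weight-2 form `s` on `Γ` with periods in the Néron lattice, square-integrable with
integrable `log ‖s‖²_pt` on `F` and `‖s‖_pt > 0` a.e., such that
`log T_D ≤ C + ε log N + log vol(F) − log ∫_F ‖s‖²_pt dμ`.
In print this is: `X_0^{D'}(M)` parametrises `E` (BCDT + Jacquet–Langlands + Faltings); Pasten
Thm 6.1(b) `log T_D ≤ log δ_{1,N} − log δ_{D',M} + O(ω(D'))`, whose proof (§6: Prop 6.13 =
Ribet–Takahashi, L.6.14–6.16, Thm 6.17, L.6.8) uses semistability / the Frey shape ONLY through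
L.6.11/L.6.12 = `FermatInput W`, and L.6.16 through "`M` has two multiplicative primes" = the
covering condition; Cor DegApproxQ `δ_{D',M} ≤ deg φ_{D',M} ≤ (9 log N)² δ_{D',M}`; the Frey–Zagier
identities (EqFreyClassical)/(EqFreyQuaternionic) `log deg = 2 log ‖·‖₂ + 2h(A)` on both curves and
`|h(A_{1,N}) − h(A_{D',M})| ≤ ½ log 163`; the Manin-constant bound Cor ManinCt (Česnavičius);
`‖f_E‖₂² ≪ N log N` (Mai–Murty; Hoffstein–Lockhart); the volume `vol(X_0^{D'}(M)) = (π/3)φ(D')ψ(M)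
≥ N^{1−ε}/C`; `ω(N) ≪ log N / log log N`; and `s :=` the pull-back of `ω_E` under
`X_0^{D'}(M) → A_{D',M} → E` (an integer multiple, `|·| ≤ 163`, of Pasten's integral `f_{D',M}`). -/
def JLPackage : Prop :=
  ∀ ε : ℝ, 0 < ε → ∃ C : ℝ, ∀ (W : WeierstrassCurve ℚ) [W.IsElliptic],
    IsSemistableAwayFromTwo W → FermatInput W → ∀ D : Finset ℕ, IsCoveringSet W D →
      ∃ (L : PeriodPair) (S : ShimuraSetup (discOf D) (W.conductorNorm ℤ / discOf D))
        (F : Set UpperHalfPlane) (s : CuspForm S.Gamma 2),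
        IsNeronPeriodPairOf W L ∧ IsHypFundamentalDomain S.Gamma F ∧ volume F ≠ 0 ∧ volume F ≠ ⊤ ∧
        s ≠ 0 ∧ HasPeriodsIn S.Gamma s (L.lattice : Set ℂ) ∧
        IntegrableOn (pet s) F ∧ IntegrableOn (fun z => Real.log (pet s z)) F ∧
        (∀ᵐ z ∂(volume.restrict F), 0 < pet s z) ∧ (0 < ∫ z in F, pet s z) ∧
        Real.log (valProd W D) ≤ C + ε * Real.log (W.conductorNorm ℤ) +
          Real.log (volume F).toReal - Real.log (∫ z in F, pet s z)

/-- **Statement of stub 4 — ZERO-CYCLE HEIGHT, analytic dress (the hard core; OPEN).** For every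
`ε > 0` there is `C` such that for every elliptic `W/ℚ` semistable away from `2`, every covering set
`D`, every Néron period pair `L`, EVERY Shimura setup `S` of level `(∏D, N/∏D)`, every fundamental
domain `F` of finite positive area and every non-zero weight-2 form `s` on `S.Gamma` with periods in
the Néron lattice (and `log ‖s‖²_pt` integrable on `F`):
  `mean_F log ‖s‖²_pt ≥ −(ε log N + C)`.
Equivalently (adjunction formula on a regular model of `X_0^D(M)`, `c₁(ω̂) = (d/vol)·μ`):
`h_ω̂(Z(s)) + V(s) ≥ ω̂² − (d/2)(ε log N + C)` — the zero cycle of the Néron-period form sits at the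
Jensen ceiling. By the package + Jensen it IMPLIES `T_D ≤ C' N^{2ε}`; conversely it is the crux for
`D` PLUS "reverse-Jensen defect `≤ ε log N`" (triage doubt 1, declared): strictly stronger than the
crux by a Planck-scale flatness statement for quaternionic eigenforms. -/
def ZeroCycleHeight : Prop :=
  ∀ ε : ℝ, 0 < ε → ∃ C : ℝ, ∀ (W : WeierstrassCurve ℚ) [W.IsElliptic],
    IsSemistableAwayFromTwo W → ∀ D : Finset ℕ, IsCoveringSet W D →
    ∀ (L : PeriodPair), IsNeronPeriodPairOf W L →
    ∀ (S : ShimuraSetup (discOf D) (W.conductorNorm ℤ / discOf D)) (F : Set UpperHalfPlane),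
      IsHypFundamentalDomain S.Gamma F → volume F ≠ 0 → volume F ≠ ⊤ →
    ∀ (s : CuspForm S.Gamma 2), s ≠ 0 → HasPeriodsIn S.Gamma s (L.lattice : Set ℂ) →
      IntegrableOn (fun z => Real.log (pet s z)) F →
        -(ε * Real.log (W.conductorNorm ℤ) + C) ≤
          (volume F).toReal⁻¹ * ∫ z in F, Real.log (pet s z)

/-- **The θ-ladder** (route header: `EigenLowerBound(θ)`; card: `FactorisationLadder`): the zero-cycle
height weakened by `θ log N` — `mean_F log ‖s‖²_pt ≥ −((θ + ε) log N + C)`. `θ = 0` is the lever;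
`θ = ω̂²/(d log N)` (`h_ω̂ ≥ 0` for algebraic points, `V ≥ 0`: the hypothesis-free Jensen rung) and
the Zhang-floor / point-floor values of `JensenDefectIdeator2.md` §2 are the rungs in reach, each
giving `T_D ≤ C N^{θ+ε}` per covering set (`pairedBoundTheta_of`) to compare with Pasten's
`N^{8/3+ε} M` (Thm 16.4). -/
def ZeroCycleHeightTheta (θ : ℝ) : Prop :=
  ∀ ε : ℝ, 0 < ε → ∃ C : ℝ, ∀ (W : WeierstrassCurve ℚ) [W.IsElliptic],
    IsSemistableAwayFromTwo W → ∀ D : Finset ℕ, IsCoveringSet W D →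
    ∀ (L : PeriodPair), IsNeronPeriodPairOf W L →
    ∀ (S : ShimuraSetup (discOf D) (W.conductorNorm ℤ / discOf D)) (F : Set UpperHalfPlane),
      IsHypFundamentalDomain S.Gamma F → volume F ≠ 0 → volume F ≠ ⊤ →
    ∀ (s : CuspForm S.Gamma 2), s ≠ 0 → HasPeriodsIn S.Gamma s (L.lattice : Set ℂ) →
      IntegrableOn (fun z => Real.log (pet s z)) F →
        -((θ + ε) * Real.log (W.conductorNorm ℤ) + C) ≤
          (volume F).toReal⁻¹ * ∫ z in F, Real.log (pet s z)

/-- The lever is the bottom rung of the ladder. -/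
theorem zeroCycleHeightTheta_zero_iff : ZeroCycleHeightTheta 0 ↔ ZeroCycleHeight := by
  simp only [ZeroCycleHeightTheta, ZeroCycleHeight, zero_add]

/-! ## The four stubs -/

/-- **Stub 1 — the Fermat input where it is known** (`FermatInputKnown`; L to formalise, KNOWN in
print: Pasten arXiv:1705.09251 L.6.11 (semistable) and L.6.12 (Frey–Hellegouarch; the argument is
verbatim for the twists by `±1, ±2`, which have the same odd discriminant part `(abc)²_odd`)). Why
it might fail: it does not at truth level. Size: L (named fact + transport along `C • W`). -/
theorem stub_fermatInputKnown : FermatInputKnown := by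
  sorry

/-- **Stub 2 — the Fermat input on the residual class** (`FermatInputResidual`; L, OPEN, FOREIGN to
the JL lever — recorded so that the composition is honest about the crux's full class; the route's
Assembly only feeds Frey–Hellegouarch curves, covered by stub 1). Why it might fail: a family of
curves additive at `2`, congruent mod large `ℓ` to a level-`2^t` newform, with every multiplicative
exponent `≡ 0 (ℓ)` (none known; each such curve is a rational point on a twist of `X(ℓ)` of genus
`≥ 3`). Size: L. -/
theorem stub_fermatInputResidual : FermatInputResidual := by
  sorry

/-- **Stub 3 — the JL / Ribet–Takahashi / Pasten package** (`JLPackage`; XL to formalise, KNOWN in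
print — see the statement's docstring for the exact chain of cited results). Why it might fail: it
does not at truth level; formalisation debt = Shimura curves `X_0^D(M)` over `ℚ`, their Jacobians and
Néron models, Jacquet–Langlands, Pasten §6 and §16. Size: XL (a Literature programme; lands as named
facts + this repackaging). -/
theorem stub_jlPackage : JLPackage := by
  sorry

/-- **Stub 4 — zero-cycle height / geometric-mean lower bound** (`ZeroCycleHeight`; XL, OPEN — THE
LEVER, HARDEST; the lead holds this one). Why plausibly true: on `X_0(N)` the analogue for the
`q`-integral newform is forced up to the Jensen defect by `(f,f) = N^{1+o(1)}`; random-wave heuristics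
put the defect at `O(1)`; every algebraic point outside Zhang's finite exceptional set has
`h_ω̂ ≥ ω̂²/(2d) − δ` (half the claim for free); the vertical part `V ≥ 0` only helps. Why it might
fail: zeros of `f_{D,M}` at the Zhang floor / a reverse-Jensen defect `≍ log N` (no tool controls
Planck-scale clustering of zeros of arithmetic eigenforms uniformly in the level). Size: XL. -/
theorem stub_zeroCycleHeight : ZeroCycleHeight := by
  sorry

/-! ## Jensen's inequality for `log` on a set of finite positive measure (PROVED) -/

/-- **Jensen for the logarithm** (`mean log u ≤ log mean u`), in the set-integral form the
composition consumes: `u` and `log u` integrable on `F`, `0 < μ F < ∞`, `u > 0` a.e. on `F`,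
`∫_F u > 0`. Proof: `log u ≤ log m + u/m − 1` pointwise a.e. (`m` = the mean), integrate. -/
theorem jensen_log {α : Type*} [MeasurableSpace α] {μ : Measure α} {F : Set α} {u : α → ℝ}
    (hF0 : μ F ≠ 0) (hFtop : μ F ≠ ⊤) (hu : IntegrableOn u F μ)
    (hlu : IntegrableOn (fun z => Real.log (u z)) F μ)
    (hpos : ∀ᵐ z ∂(μ.restrict F), 0 < u z) (hint : 0 < ∫ z in F, u z ∂μ) :
    (μ F).toReal⁻¹ * ∫ z in F, Real.log (u z) ∂μ ≤
      Real.log ((μ F).toReal⁻¹ * ∫ z in F, u z ∂μ) := by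
  set V : ℝ := (μ F).toReal with hV
  set I : ℝ := ∫ z in F, u z ∂μ with hI
  have hVpos : 0 < V := ENNReal.toReal_pos hF0 hFtop
  set m : ℝ := V⁻¹ * I with hm
  have hmpos : 0 < m := mul_pos (inv_pos.mpr hVpos) hint
  haveI : IsFiniteMeasure (μ.restrict F) := ⟨by rwa [Measure.restrict_apply_univ, lt_top_iff_ne_top]⟩
  -- pointwise: log u ≤ (log m - 1) + u / m, almost everywhere on F
  have hpt : ∀ᵐ z ∂(μ.restrict F), Real.log (u z) ≤ (Real.log m - 1) + u z / m := by
    filter_upwards [hpos] with z hz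
    have h1 : Real.log (u z / m) ≤ u z / m - 1 := Real.log_le_sub_one_of_pos (div_pos hz hmpos)
    rw [Real.log_div hz.ne' hmpos.ne'] at h1
    linarith
  have hgi : Integrable (fun z => (Real.log m - 1) + u z / m) (μ.restrict F) :=
    (integrable_const _).add (hu.div_const m)
  have hle : ∫ z in F, Real.log (u z) ∂μ ≤ ∫ z in F, ((Real.log m - 1) + u z / m) ∂μ :=
    integral_mono_ae hlu hgi hpt
  have hrhs : ∫ z in F, ((Real.log m - 1) + u z / m) ∂μ = V * Real.log m := by
    rw [integral_add (integrable_const _) (hu.div_const m), integral_const, integral_div,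
      measureReal_restrict_apply_univ, measureReal_def, ← hV, smul_eq_mul, ← hI]
    have hmI : I / m = V := by
      rw [hm]; field_simp [hint.ne', hVpos.ne']
    rw [hmI]; ring
  rw [hrhs] at hle
  calc V⁻¹ * ∫ z in F, Real.log (u z) ∂μ ≤ V⁻¹ * (V * Real.log m) :=
        mul_le_mul_of_nonneg_left hle (inv_nonneg.mpr hVpos.le)
    _ = Real.log m := by rw [← mul_assoc, inv_mul_cancel₀ hVpos.ne', one_mul]

/-! ## The analytic composition (PROVED): package + Jensen + zero-cycle height ⟹ the paired bound -/

/-- A covering set forces `≥ 4` multiplicative primes. -/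
theorem four_le_card_multPrimes {W : WeierstrassCurve ℚ} {D : Finset ℕ} (hD : IsCoveringSet W D) :
    4 ≤ (multPrimes W).card := by
  obtain ⟨hsub, -, h2, h2'⟩ := hD
  have h := Finset.card_sdiff_add_card_eq_card hsub
  omega

/-- **The engine of the line.** `FermatInputOnClass → JLPackage → ZeroCycleHeight →
PairedFactorisationBound`: for a covering set `D`, the package gives `(L, S, F, s)` with
`log T_D ≤ C₁ + (ε/2) log N + log vol F − log ∫_F ‖s‖²_pt`; Jensen gives
`mean_F log ‖s‖²_pt ≤ log (vol F)⁻¹ ∫_F ‖s‖²_pt`; the zero-cycle height gives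
`mean_F log ‖s‖²_pt ≥ −((ε/2) log N + C₂)`; hence `log T_D ≤ C₁ + C₂ + ε log N`, i.e.
`T_D ≤ e^{C₁+C₂} N^ε`. -/
theorem pairedFactorisationBound_of (hFI : FermatInputOnClass) (hJL : JLPackage)
    (hZ : ZeroCycleHeight) : PairedFactorisationBound := by
  intro ε hε
  have hε2 : 0 < ε / 2 := half_pos hε
  obtain ⟨C₁, hC₁⟩ := hJL (ε / 2) hε2
  obtain ⟨C₂, hC₂⟩ := hZ (ε / 2) hε2
  refine ⟨Real.exp (C₁ + C₂), fun W _ hss D hD => ?_⟩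
  have hF : FermatInput W := hFI W hss (four_le_card_multPrimes hD)
  obtain ⟨L, S, F, s, hL, hFD, hF0, hFt, hs0, hper, hint₁, hint₂, hpos, hIpos, hineq⟩ :=
    hC₁ W hss hF D hD
  have hz := hC₂ W hss D hD L hL S F hFD hF0 hFt s hs0 hper hint₂
  have hJ := jensen_log hF0 hFt hint₁ hint₂ hpos hIpos
  set N : ℝ := (W.conductorNorm ℤ : ℝ) with hNdef
  set V : ℝ := (volume F).toReal with hVdef
  set I : ℝ := ∫ z in F, pet s z with hIdef
  have hV : 0 < V := ENNReal.toReal_pos hF0 hFt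
  have hlogVI : Real.log (V⁻¹ * I) = Real.log I - Real.log V := by
    rw [Real.log_mul (inv_ne_zero hV.ne') hIpos.ne', Real.log_inv]; ring
  rw [hlogVI] at hJ
  have hlogT : Real.log (valProd W D) ≤ C₁ + C₂ + ε * Real.log N := by linarith
  have hN0 : 0 < W.conductorNorm ℤ := W.conductorNorm_pos_holds
  have hN : 0 < N := by rw [hNdef]; exact_mod_cast hN0
  have hT : (valProd W D : ℝ) ≤ Real.exp (Real.log (valProd W D)) := by
    rcases Nat.eq_zero_or_pos (valProd W D) with h | h
    · rw [h]; simp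
    · rw [Real.exp_log (by exact_mod_cast h)]
  calc (valProd W D : ℝ) ≤ Real.exp (Real.log (valProd W D)) := hT
    _ ≤ Real.exp (C₁ + C₂ + ε * Real.log N) := Real.exp_le_exp.mpr hlogT
    _ = Real.exp (C₁ + C₂) * N ^ ε := by
        rw [Real.exp_add, Real.rpow_def_of_pos hN, mul_comm (Real.log N) ε]

/-! ## The covering glue (PROVED): the paired bound implies the crux -/

section Covering

variable (W : WeierstrassCurve ℚ)

/-- Every factor of `T(E)` is `≥ 1`: a prime of the conductor divides the minimal discriminant
(`radical_conductorNorm_eq_holds`, PROVED in the tree). -/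
theorem one_le_factorization_of_mem_multPrimes [W.IsElliptic] {p : ℕ} (hp : p ∈ multPrimes W) :
    1 ≤ (W.minimalDiscriminantNorm ℤ).factorization p := by
  have hrad : UniqueFactorizationMonoid.radical (W.conductorNorm ℤ) =
      UniqueFactorizationMonoid.radical (W.minimalDiscriminantNorm ℤ) :=
    W.radical_conductorNorm_eq_holds
  have hpf : (W.conductorNorm ℤ).primeFactors = (W.minimalDiscriminantNorm ℤ).primeFactors := by
    rw [← Nat.primeFactors_radical, hrad, Nat.primeFactors_radical]
  have hp1 : p ∈ (W.conductorNorm ℤ).primeFactors := (Finset.mem_filter.mp hp).1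
  rw [hpf] at hp1
  obtain ⟨hpp, hpd, hne⟩ := Nat.mem_primeFactors.mp hp1
  exact (hpp.factorization_pos_of_dvd hne hpd)

variable {W} in
/-- Splitting a valuation product along `A ⊆ S` with `S ∖ A ⊆ B ⊆ multPrimes`:
`T_S ≤ T_A · T_B` (all factors over multiplicative primes are `≥ 1`). -/
theorem valProd_le_mul [W.IsElliptic] {S A B : Finset ℕ} (hA : A ⊆ S) (hSB : S \ A ⊆ B)
    (hB : B ⊆ multPrimes W) : valProd W S ≤ valProd W A * valProd W B := by
  classical
  unfold valProd
  rw [← Finset.prod_sdiff hA, mul_comm]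
  refine Nat.mul_le_mul_left _ ?_
  exact Finset.prod_le_prod_of_subset_of_one_le' hSB
    (fun p hp _ => one_le_factorization_of_mem_multPrimes W (hB hp))

variable {W} in
/-- **Three covering sets.** With `≥ 4` multiplicative primes there are covering sets `D₁, D₂, D₃`
with `T(E) ≤ T_{D₁} T_{D₂} T_{D₃}`: `m` even ⇒ `S ∖ {a,b}`, `{a,b}`, `{a,b}`; `m` odd ⇒
`S ∖ {a,b,c}`, `{a,b}`, `{a,c}`. -/
theorem exists_three_coveringSets [W.IsElliptic] (h4 : 4 ≤ (multPrimes W).card) :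
    ∃ D₁ D₂ D₃ : Finset ℕ, IsCoveringSet W D₁ ∧ IsCoveringSet W D₂ ∧ IsCoveringSet W D₃ ∧
      valProd W (multPrimes W) ≤ valProd W D₁ * valProd W D₂ * valProd W D₃ := by
  classical
  set S := multPrimes W with hS
  -- three distinct multiplicative primes
  obtain ⟨a, ha⟩ : S.Nonempty := Finset.card_pos.mp (by omega)
  obtain ⟨b, hb⟩ : (S.erase a).Nonempty :=
    Finset.card_pos.mp (by rw [Finset.card_erase_of_mem ha]; omega)
  obtain ⟨c, hc⟩ : ((S.erase a).erase b).Nonempty :=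
    Finset.card_pos.mp (by rw [Finset.card_erase_of_mem hb, Finset.card_erase_of_mem ha]; omega)
  have hba : b ≠ a := (Finset.mem_erase.mp hb).1
  have hbS : b ∈ S := (Finset.mem_erase.mp hb).2
  have hcb : c ≠ b := (Finset.mem_erase.mp hc).1
  have hc' : c ∈ S.erase a := (Finset.mem_erase.mp hc).2
  have hca : c ≠ a := (Finset.mem_erase.mp hc').1
  have hcS : c ∈ S := (Finset.mem_erase.mp hc').2
  have hab : a ≠ b := hba.symm
  -- the pairs
  have hpab : ({a, b} : Finset ℕ) ⊆ S := by
    intro x hx; rcases Finset.mem_insert.mp hx with rfl | hx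
    · exact ha
    · rwa [Finset.mem_singleton.mp hx]
  have hpac : ({a, c} : Finset ℕ) ⊆ S := by
    intro x hx; rcases Finset.mem_insert.mp hx with rfl | hx
    · exact ha
    · rwa [Finset.mem_singleton.mp hx]
  have hcab : ({a, b} : Finset ℕ).card = 2 := Finset.card_pair hab
  have hcac : ({a, c} : Finset ℕ).card = 2 := Finset.card_pair hca.symm
  have covPair : ∀ {x y : ℕ}, x ≠ y → ({x, y} : Finset ℕ) ⊆ S → IsCoveringSet W {x, y} := by
    intro x y hxy hsub
    refine ⟨hsub, ?_, ?_, ?_⟩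
    · rw [Finset.card_pair hxy]; exact even_two
    · rw [Finset.card_pair hxy]
    · rw [Finset.card_sdiff_of_subset hsub, Finset.card_pair hxy]; omega
  have hD₂ : IsCoveringSet W {a, b} := covPair hab hpab
  have hD₃ : IsCoveringSet W {a, c} := covPair hca.symm hpac
  rcases Nat.even_or_odd S.card with heven | hodd
  · -- even: D₁ = S ∖ {a,b}, D₂ = D₃ = {a,b}
    refine ⟨S \ {a, b}, {a, b}, {a, b}, ?_, hD₂, hD₂, ?_⟩
    · refine ⟨Finset.sdiff_subset, ?_, ?_, ?_⟩
      · rw [Finset.card_sdiff_of_subset hpab, hcab]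
        exact (Nat.even_sub (by omega)).mpr (by simp [heven])
      · rw [Finset.card_sdiff_of_subset hpab, hcab]; omega
      · rw [Finset.sdiff_sdiff_eq_self hpab, hcab]
    · have h1 : valProd W S ≤ valProd W (S \ {a, b}) * valProd W {a, b} :=
        valProd_le_mul Finset.sdiff_subset (by rw [Finset.sdiff_sdiff_eq_self hpab]) hpab
      have h2 : 1 ≤ valProd W {a, b} := by
        unfold valProd
        exact Finset.one_le_prod' fun p hp => one_le_factorization_of_mem_multPrimes W (hpab hp)
      calc valProd W S ≤ valProd W (S \ {a, b}) * valProd W {a, b} := h1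
        _ ≤ valProd W (S \ {a, b}) * valProd W {a, b} * valProd W {a, b} :=
            Nat.le_mul_of_pos_right _ h2
  · -- odd: D₁ = S ∖ {a,b,c}, D₂ = {a,b}, D₃ = {a,c}
    have hpabc : ({a, b, c} : Finset ℕ) ⊆ S := by
      intro x hx
      rcases Finset.mem_insert.mp hx with rfl | hx
      · exact ha
      rcases Finset.mem_insert.mp hx with rfl | hx
      · exact hbS
      · rwa [Finset.mem_singleton.mp hx]
    have hcabc : ({a, b, c} : Finset ℕ).card = 3 :=
      Finset.card_eq_three.mpr ⟨a, b, c, hab, hca.symm, hcb.symm, rfl⟩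
    have h5 : 5 ≤ S.card := by
      rcases hodd with ⟨k, hk⟩; omega
    refine ⟨S \ {a, b, c}, {a, b}, {a, c}, ?_, hD₂, hD₃, ?_⟩
    · refine ⟨Finset.sdiff_subset, ?_, ?_, ?_⟩
      · rw [Finset.card_sdiff_of_subset hpabc, hcabc]
        refine (Nat.even_sub (by omega)).mpr ⟨fun h => ?_, fun h => ?_⟩
        · exact absurd h (Nat.not_even_iff_odd.mpr hodd)
        · exact absurd h (by decide)
      · rw [Finset.card_sdiff_of_subset hpabc, hcabc]; omega
      · rw [Finset.sdiff_sdiff_eq_self hpabc, hcabc]; omega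
    · have h1 : valProd W S ≤ valProd W (S \ {a, b, c}) * valProd W {a, b, c} :=
        valProd_le_mul Finset.sdiff_subset (by rw [Finset.sdiff_sdiff_eq_self hpabc]) hpabc
      have hsub2 : ({a, b} : Finset ℕ) ⊆ {a, b, c} := by
        intro x hx
        rcases Finset.mem_insert.mp hx with rfl | hx
        · exact Finset.mem_insert_self _ _
        · rw [Finset.mem_singleton.mp hx]
          exact Finset.mem_insert_of_mem (Finset.mem_insert_self _ _)
      have hrest : ({a, b, c} : Finset ℕ) \ {a, b} ⊆ {a, c} := by
        intro x hx
        have hx1 := (Finset.mem_sdiff.mp hx).1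
        have hx2 := (Finset.mem_sdiff.mp hx).2
        rcases Finset.mem_insert.mp hx1 with rfl | hx1
        · exact Finset.mem_insert_self _ _
        rcases Finset.mem_insert.mp hx1 with rfl | hx1
        · exact absurd (Finset.mem_insert_of_mem (Finset.mem_singleton_self _)) hx2
        · rw [Finset.mem_singleton.mp hx1]
          exact Finset.mem_insert_of_mem (Finset.mem_singleton_self _)
      have h2 : valProd W {a, b, c} ≤ valProd W {a, b} * valProd W {a, c} :=
        valProd_le_mul hsub2 hrest hpac
      calc valProd W S ≤ valProd W (S \ {a, b, c}) * valProd W {a, b, c} := h1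
        _ ≤ valProd W (S \ {a, b, c}) * (valProd W {a, b} * valProd W {a, c}) :=
            Nat.mul_le_mul_left _ h2
        _ = valProd W (S \ {a, b, c}) * valProd W {a, b} * valProd W {a, c} := by ring

end Covering

/-- **The covering glue, PROVED**: the per-factorisation bound at `ε/3` on three covering sets
gives the crux at `ε` (`T ≤ T_{D₁}T_{D₂}T_{D₃} ≤ (max C 1)³ N^ε`). -/
theorem coveringGlue : CoveringGlue := by
  intro hP ε hε
  obtain ⟨C, hC⟩ := hP (ε / 3) (by positivity)
  refine ⟨(max C 1) ^ 3, fun W _ hss h4 => ?_⟩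
  have hS4 : 4 ≤ (multPrimes W).card := by
    refine le_trans h4 (Finset.card_le_card fun p hp => ?_)
    simp only [multPrimes, Finset.mem_filter] at hp ⊢
    exact ⟨hp.1, hp.2.2⟩
  obtain ⟨D₁, D₂, D₃, hD₁, hD₂, hD₃, hprod⟩ := exists_three_coveringSets (W := W) hS4
  have hN0' : 0 < W.conductorNorm ℤ := W.conductorNorm_pos_holds
  set N : ℝ := (W.conductorNorm ℤ : ℝ) with hNdef
  have hN0 : 0 < N := by rw [hNdef]; exact_mod_cast hN0'
  have hb : ∀ D, IsCoveringSet W D → (valProd W D : ℝ) ≤ max C 1 * N ^ (ε / 3) := fun D hD =>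
    (hC W hss D hD).trans (mul_le_mul_of_nonneg_right (le_max_left _ _) (Real.rpow_nonneg hN0.le _))
  have hTS : (∏ p ∈ (W.conductorNorm ℤ).primeFactors with ¬ p ^ 2 ∣ W.conductorNorm ℤ,
      (W.minimalDiscriminantNorm ℤ).factorization p) = valProd W (multPrimes W) := rfl
  rw [hTS]
  have hpow : (N ^ (ε / 3)) ^ (3 : ℕ) = N ^ ε := by
    rw [← Real.rpow_natCast, ← Real.rpow_mul hN0.le]; norm_num
  calc (valProd W (multPrimes W) : ℝ) ≤ (valProd W D₁ : ℝ) * valProd W D₂ * valProd W D₃ := by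
        exact_mod_cast hprod
    _ ≤ (max C 1 * N ^ (ε / 3)) * (max C 1 * N ^ (ε / 3)) * (max C 1 * N ^ (ε / 3)) := by
        gcongr
        · exact hb D₁ hD₁
        · exact hb D₂ hD₂
        · exact hb D₃ hD₃
    _ = (max C 1) ^ 3 * (N ^ (ε / 3)) ^ (3 : ℕ) := by ring
    _ = (max C 1) ^ 3 * N ^ ε := by rw [hpow]

/-! ## The crux from the line -/

/-- **The crux from the line** — the ONLY theorem of this file concluding
`Summit.ABC.ABC.Theses.RibetTakahashiSplit.ManyPrimeValuationProduct`, BY NAME; no hypotheses, the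
four registered stubs are INVOKED (sorries live only in `stub_*`; everything else is kernel-closed).
Chain: Fermat input (known ∪ residual, `fermatInputOnClass_of`) + package + zero-cycle height ⟹
`PairedFactorisationBound` (`pairedFactorisationBound_of`: Jensen, proved) ⟹ the crux
(`coveringGlue`: three covering sets, proved). -/
theorem ManyPrimeValuationProduct_of : ManyPrimeValuationProduct :=
  coveringGlue (pairedFactorisationBound_of
    (fermatInputOnClass_of stub_fermatInputKnown stub_fermatInputResidual)
    stub_jlPackage stub_zeroCycleHeight)

/-- **The θ-ladder, kernel-checked, and the reach of the line without stub 2's open part.** The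
package, Jensen and the `θ`-weakened zero-cycle height give `T_D ≤ C N^{θ+ε}` for every covering set
of every curve semistable away from `2` that satisfies the Fermat input — in particular (Pasten
L.6.11/L.6.12) for all semistable and all Frey–Hellegouarch curves, which is everything
`RibetTakahashiSplit.Assembly` feeds into the crux. At `θ = 0` this is the engine of
`pairedFactorisationBound_of`. -/
theorem pairedBoundTheta_of (θ : ℝ) (hJL : JLPackage) (hZ : ZeroCycleHeightTheta θ) :
    ∀ ε : ℝ, 0 < ε → ∃ C : ℝ, ∀ (W : WeierstrassCurve ℚ) [W.IsElliptic],
      IsSemistableAwayFromTwo W → FermatInput W → ∀ D : Finset ℕ, IsCoveringSet W D →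
        (valProd W D : ℝ) ≤ C * (W.conductorNorm ℤ : ℝ) ^ (θ + ε) := by
  intro ε hε
  have hε2 : 0 < ε / 2 := half_pos hε
  obtain ⟨C₁, hC₁⟩ := hJL (ε / 2) hε2
  obtain ⟨C₂, hC₂⟩ := hZ (ε / 2) hε2
  refine ⟨Real.exp (C₁ + C₂), fun W _ hss hF D hD => ?_⟩
  obtain ⟨L, S, F, s, hL, hFD, hF0, hFt, hs0, hper, hint₁, hint₂, hpos, hIpos, hineq⟩ :=
    hC₁ W hss hF D hD
  have hz := hC₂ W hss D hD L hL S F hFD hF0 hFt s hs0 hper hint₂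
  have hJ := jensen_log hF0 hFt hint₁ hint₂ hpos hIpos
  set N : ℝ := (W.conductorNorm ℤ : ℝ) with hNdef
  set V : ℝ := (volume F).toReal with hVdef
  set I : ℝ := ∫ z in F, pet s z with hIdef
  have hV : 0 < V := ENNReal.toReal_pos hF0 hFt
  have hlogVI : Real.log (V⁻¹ * I) = Real.log I - Real.log V := by
    rw [Real.log_mul (inv_ne_zero hV.ne') hIpos.ne', Real.log_inv]; ring
  rw [hlogVI] at hJ
  have hlogT : Real.log (valProd W D) ≤ C₁ + C₂ + (θ + ε) * Real.log N := by linarith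
  have hN0 : 0 < W.conductorNorm ℤ := W.conductorNorm_pos_holds
  have hN : 0 < N := by rw [hNdef]; exact_mod_cast hN0
  have hT : (valProd W D : ℝ) ≤ Real.exp (Real.log (valProd W D)) := by
    rcases Nat.eq_zero_or_pos (valProd W D) with h | h
    · rw [h]; simp
    · rw [Real.exp_log (by exact_mod_cast h)]
  calc (valProd W D : ℝ) ≤ Real.exp (Real.log (valProd W D)) := hT
    _ ≤ Real.exp (C₁ + C₂ + (θ + ε) * Real.log N) := Real.exp_le_exp.mpr hlogT
    _ = Real.exp (C₁ + C₂) * N ^ (θ + ε) := by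
        rw [Real.exp_add, Real.rpow_def_of_pos hN, mul_comm (Real.log N) (θ + ε)]

end Summit.ABC.ABC.Cruxes.ManyPrimeValuationProduct.JlZeroCycleHeight

/-! ## Co-registered stubs of the FIRST lead's line `unramified-window-census`

The gate keeps ONE skeleton registration per crux (observed 2026-08-16T03:25Z: registering this file
expired the first lead's stubs). So that both concurrently-led lines keep their stubs ACTIVE under a
single registration, the three registered stubs of `Lines/unramified-window-census.lean` (rev 2, lead
prover-line-stmt-ABC-1561-0) are repeated here VERBATIM — same namespace, names and signatures. They are
NOT used by `JlZeroCycleHeight.ManyPrimeValuationProduct_of`; they are owned, proved and reshaped by the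
first lead only (this seat never briefs a worker on them). `stub_omegaLogLog` is already landed
(`Summit.ABC.ABC.Theorems.stub_omegaLogLog`, p76120). -/

namespace Summit.ABC.ABC.Cruxes.ManyPrimeValuationProduct.UnramifiedWindowCensus

open scoped BigOperators
open Finset

/-- (first lead's stub 1, LANDED as `Summit.ABC.ABC.Theorems.stub_omegaLogLog`, p76120; repeated for
co-registration only) `ω(n)·log log n ≤ C₀ log n`. -/
theorem stub_omegaLogLog :
    ∃ C₀ : ℝ, ∀ n : ℕ, (n.primeFactors.card : ℝ) * Real.log (Real.log n) ≤ C₀ * Real.log n := by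
  sorry

/-- (first lead's stub 2, HARDEST of that line; repeated for co-registration only) mid-exponent census:
`#{p ∥ N : log ord_p Δ_min > ε log log N} · log log N ≤ ε log N + C` on the class. -/
theorem stub_midCensus :
    ∀ ε : ℝ, 0 < ε → ∃ C : ℝ, ∀ (W : WeierstrassCurve ℚ) [W.IsElliptic],
      (∀ p : ℕ, p.Prime → p ≠ 2 → ¬ p ^ 2 ∣ W.conductorNorm ℤ) →
      4 ≤ ((W.conductorNorm ℤ).primeFactors.filter
        (fun p => p ≠ 2 ∧ ¬ p ^ 2 ∣ W.conductorNorm ℤ)).card →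
      ((((W.conductorNorm ℤ).primeFactors.filter (fun p => ¬ p ^ 2 ∣ W.conductorNorm ℤ)).filter
          (fun p => ε * Real.log (Real.log (W.conductorNorm ℤ)) <
            Real.log ((W.minimalDiscriminantNorm ℤ).factorization p))).card : ℝ) *
        Real.log (Real.log (W.conductorNorm ℤ)) ≤ ε * Real.log (W.conductorNorm ℤ) + C := by
  sorry

/-- (first lead's stub 3; repeated for co-registration only) giant-exponent mass:
`Σ_{p ∥ N, ord_p Δ_min > log N} log ord_p Δ_min ≤ ε log N + C` on the class. -/
theorem stub_giantMass :
    ∀ ε : ℝ, 0 < ε → ∃ C : ℝ, ∀ (W : WeierstrassCurve ℚ) [W.IsElliptic],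
      (∀ p : ℕ, p.Prime → p ≠ 2 → ¬ p ^ 2 ∣ W.conductorNorm ℤ) →
      4 ≤ ((W.conductorNorm ℤ).primeFactors.filter
        (fun p => p ≠ 2 ∧ ¬ p ^ 2 ∣ W.conductorNorm ℤ)).card →
      ∑ p ∈ ((W.conductorNorm ℤ).primeFactors.filter (fun p => ¬ p ^ 2 ∣ W.conductorNorm ℤ)).filter
          (fun p => Real.log (W.conductorNorm ℤ) <
            (((W.minimalDiscriminantNorm ℤ).factorization p : ℕ) : ℝ)),
        Real.log ((W.minimalDiscriminantNorm ℤ).factorization p) ≤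
          ε * Real.log (W.conductorNorm ℤ) + C := by
  sorry

end Summit.ABC.ABC.Cruxes.ManyPrimeValuationProduct.UnramifiedWindowCensus

end
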